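import Literature.Analysis.FluidPDE.Ferrari1993EnergyIdentity
import Literature.Analysis.FluidPDE.SerrinEnstrophyGronwall
import HarnessLib

/-!
# The `H^s` energy inequality `Ferrari1993_periodicCylinderHsEnergyInequality` from the commutator
estimate and the pressure estimate

Topic `Literature/Analysis/FluidPDE`. Fifth file of the decomposition of the named fact
`Literature.Analysis.FluidPDE.Ferrari1993_periodicCylinderH3Bound` (`Ferrari1993Continuation.lean`;
A. B. Ferrari, Comm. Math. Phys. **155** (1993), proof of Thm 2). `Ferrari1993H3Bound.lean` reduced
the target to the `H^s` energy inequality (13)–(14),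
`|u(t)|_s ≤ |u₀|_s exp(C ∫₀ᵗ |u|_{W^{1,∞}})` (`Ferrari1993_periodicCylinderHsEnergyInequality`), and a
logarithmic estimate. The printed derivation of (13) (p. 280–281) has two analytic inputs and is
otherwise the `D^α`-energy method:

1. the **commutator estimate** — the display following Lemma 1, p. 280: "Applying to (8) the
   second part of the lemma with `f = u` and `g = ∇u` implies
   `½ d/dt |D^α u|² ≤ C |D^α u| (|u|_s |u|_{W^{1,∞}} + |D^α ∇p|)`", i.e.
   `|u·D^α∇u − D^α(u·∇u)|_{L²} ≤ C |u|_{H^s} |u|_{W^{1,∞}}` for `|α| ≤ s` (Lemma 1 ii), the Moser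
   calculus inequality, "easily derived using extension operators … together with the free space
   versions" — Klainerman–Majda, Beale–Kato–Majda) — vendored here as the named fact
   `Ferrari1993_periodicCylinderCommutatorEstimate`;
2. the **pressure estimate**, Lemma 2, pp. 280–281: `|∇p|_{H^s} ≤ C |u|_{W^{1,∞}} |u|_{H^s}` for a
   solution of (1)–(3) (the Neumann problem (10)–(12) up to the boundary) — vendored here as the
   named fact `Ferrari1993_periodicCylinderPressureEstimate`;
3. everything else — the energy identity (8) with the vanishing of the transport term
   (`Ferrari1993EnergyIdentity.lean`), the summation over `|α| ≤ s` (9), (13), and Gronwall (14) —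
   is **proved** here: `Ferrari1993_periodicCylinderHsEnergyInequality_of_commutator_of_pressure :
   1 → 2 → (13)–(14)`.

The Gronwall step is run in the form required by the rendering of (14) in the tree (prefactor `1`
in front of `‖u₀‖_{H³(cell)}` for the *sum-form* norm `N = Σ_w ‖D_w u‖_{L²(cell)}`, and a bound `B`
of the *lower* Lebesgue integral of the possibly non-measurable `t ↦ ‖u(t)‖_{W^{1,∞}(cell)}`):
`sum_sqrt_le_mul_exp_of_energy_ineq` — if finitely many energies `E_j ≥ 0`, continuous on `[0, t]`
and differentiable inside with continuous derivatives `φ_j ≤ 2 √E_j k_j`, satisfy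
`Σ_j k_j ≤ C w Σ_j √E_j` with `∫⁻_{(0,t)} w ≤ B`, then `Σ_j √E_j(t) ≤ (Σ_j √E_j(0)) e^{CB}`
(regularise `N_ε = Σ_j √(E_j + ε²)`, `N_ε' ≤ Σ_j k_j ≤ C w N_ε`, integrate, apply the
measurability-free Gronwall lemma `lintegral_gronwall_le` of `SerrinEnstrophyGronwall.lean` to
`ofReal ∘ N_ε`, let `ε → 0`). With `E_w(s) = ∫_cell ‖D_w u(s)‖²` over the words `w` of length `≤ 3`
in the basis of the tree's norm (`cylWordField`), `k_w = ‖[D_w,u·∇]u‖_{L²} + ‖D_w∇p‖_{L²}`,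
`w(s) = ‖u(s)‖_{W^{1,∞}(cell)}` and `Σ_w √E_w = ‖u‖_{H³(cell)}` (word expansion
`eSobolevDomainNorm_eq_sum_iterDeriv`), facts 1–2 give `Σ_w k_w ≤ #words·(C₁ + C₂) w N`.

Consequences recorded: the target on the three single-estimate facts — commutator, pressure,
stationary log div–curl (`Ferrari1993_periodicCylinderH3Bound_of_commutator_of_pressure_of_divCurl`);
the continuation / BKM chain adds Kato–Lai's uniform-time existence as a fourth
(`Ferrari1993CommutatorFromMoser.lean`).

## Faithfulness / what is NOT here

* Fact 1 is rendered on the open period cell `{r < 1} × (0, L)` of the periodic cylinder for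
  velocity fields `C^∞` on the closed cylinder and `L`-periodic (the time slices of the class),
  with ordered directional derivatives `D_w` along words in the basis `(eᵢ) = Module.finBasis ℝ ℝ³`
  of the tree's Sobolev norm in place of the `D^α` (each `D_w`, `|w| = m`, is a fixed linear
  combination of the `D^α`, `|α| = m`, and conversely, so the printed estimate and the rendered one
  are equivalent up to the constant) and the tree's norms `eSobolevDomainNorm 1 ∞` /
  `eSobolevDomainNorm 3 2` on the cell for `|u|_{W^{1,∞}}`, `|u|_{H³}`; `s = 3`. Fact 2 is rendered
  in the class `IsPeriodicCylinderEulerSolution` (Lemma 2 is stated for solutions of (1)–(3)), for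
  the classical gradient `∇p(t)` on the cell. Both inherit the adaptation caveat of the chain: the
  printed lemmas concern bounded smooth domains of `ℝ³` (Lemma 1 via extension operators, Lemma 2
  via the Neumann problem and the trace theorem), while the periodic cylinder `{r ≤ 1} × ℝ/Lℤ` is a
  compact flat manifold with boundary, whose period cell is a bounded convex (Lipschitz) domain
  (Stein extension); this is the use made of these estimates by Luo–Hou 2014 §4.4 and Chen–Hou
  2021 §9 (and Kato–Lai 1984 §4 for the pressure).
* Not here: the discharge of fact 1 (Gagliardo–Nirenberg / Moser inequalities on the cell via
  extension) or of fact 2 (elliptic `H^s` regularity for the Neumann problem up to the curved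
  boundary) — Sobolev theory on domains absent from Mathlib.

Mathlib/tree search: no commutator / Kato–Ponce / Moser estimate on domains in the tree
(`lean search 'commutator.*estimate|KatoPonce|Moser'`: torus versions only,
`TorusCommutatorEstimate`); no Neumann regularity. Used: `lintegral_gronwall_le`,
`lintegral_Ioo_eq_lintegral_Ioc` (`SerrinEnstrophyGronwall`), `HasDerivAt.sqrt`, `HasDerivAt.fun_sum`,
`intervalIntegral.integral_eq_sub_of_hasDerivAt_of_le`, `ofReal_integral_eq_lintegral_ofReal`,
`lintegral_const_mul'`, `Finset.sum_sigma`.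
-/

noncomputable section

open MeasureTheory Set Function Filter Topology TopologicalSpace WithLp
open scoped ContDiff NNReal ENNReal InnerProductSpace RealInnerProductSpace

namespace Literature.Analysis.FluidPDE

open Literature.Analysis.FunctionSpaces

/-- Local notation for physical space `ℝ³ = EuclideanSpace ℝ (Fin 3)`. -/
local notation "ℝ³" => EuclideanSpace ℝ (Fin 3)

/-! ### The two named facts -/

/-- **The commutator estimate** (Ferrari 1993, p. 280, the display following Lemma 1: "Applying to
(8) the second part of the lemma with `f = u` and `g = ∇u` implies
`½ d/dt |D^α u|²_{L²} ≤ C |D^α u|_{L²} (|u|_s |u|_{W^{1,∞}} + |D^α ∇p|_{L²})`", that is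
`|u·D^α∇u − D^α(u·∇u)|_{L²(Ω)} ≤ C |u|_{H^s(Ω)} |u|_{W^{1,∞}(Ω)}` for `|α| ≤ s`, `Ω ⊂ ℝ³` bounded with
smooth boundary; Lemma 1 ii): for `f ∈ H^s ∩ C¹(Ω̄)`, `g ∈ H^{s−1} ∩ C(Ω̄)`, `|α| ≤ s`,
`‖D^α(fg) − f D^α g‖_{L²} ≤ C(‖f‖_{H^s} ‖g‖_{L^∞} + ‖∇f‖_{L^∞} ‖g‖_{H^{s−1}})`, "easily derived using
extension operators, well-known to be bounded on the necessary spaces, together with the free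
space versions of the estimates" of Klainerman–Majda and Beale–Kato–Majda). **Rendering** (`s = 3`;
open period cell `{r < 1} × (0, L)` of the periodic cylinder; velocity fields `C^∞` on the closed
cylinder and `L`-periodic in `z` — the time slices of `IsPeriodicCylinderEulerSolution`; ordered
directional derivatives `D_w = iterDeriv m (sobolevDir w)` along the words `w` of length `m ≤ 3` in
the basis `(eᵢ) = Module.finBasis ℝ ℝ³` of the tree's Sobolev norm in place of the `D^α` — an
equivalent family up to constants; the commutator `[D_w, v·∇]v = D_w((v·∇)v) − (v·∇)D_w v` is
`convectionCommutator m w v`; norms `eSobolevDomainNorm 1 ∞` and `eSobolevDomainNorm 3 2` on the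
cell, in `ℝ≥0∞`): for `L > 0` there is `C` with
`‖[D_w, v·∇]v‖_{L²(cell)} ≤ C ‖v‖_{W^{1,∞}(cell)} ‖v‖_{H³(cell)}` for all such `v` and all words of
length `≤ 3`. Adaptation caveat as in `Ferrari1993_periodicCylinderH3Bound` (bounded smooth domain of
`ℝ³` → periodic cylinder `{r ≤ 1} × ℝ/Lℤ`, a compact flat manifold with boundary whose period cell
is a bounded convex domain; Luo–Hou 2014 §4.4, Chen–Hou 2021 §9). [cite: Ferrari1993, Lemma 1 ii) and the display following it, p. 280]
[cite: LuoHou2014, §4.4 p. 1744 (use in the periodic cylinder)] -/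
def Ferrari1993_periodicCylinderCommutatorEstimate : Prop :=
  ∀ (L : ℝ) (_hL : 0 < L), ∃ C : ℝ≥0, ∀ (v : ℝ³ → ℝ³)
    (_hv : ContDiffOn ℝ ∞ v (closure (unitCylinder : Set ℝ³))) (_hper : IsAxiallyPeriodic L v)
    (m : ℕ) (_hm : m ≤ 3) (w : Fin m → Fin (Module.finrank ℝ ℝ³)),
    eLpNorm (convectionCommutator m w v) 2 (volume.restrict (cylinderCell L : Set ℝ³)) ≤
      C * eSobolevDomainNorm 1 ∞ (cylinderCell L) volume v *
        eSobolevDomainNorm 3 2 (cylinderCell L) volume v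

/-- **The pressure estimate** (Ferrari 1993, Lemma 2, pp. 280–281: "If `u ∈ H^s(Ω)` and
`p ∈ H^{s+1}(Ω)`, `s ≥ 3`," solve the Euler equations (1)–(3) in the bounded domain `Ω ⊂ ℝ³` with
smooth boundary, "then `|∇p|_{H^s} ≤ C |u|_{W^{1,∞}} |u|_{H^s}`"; proof: the Neumann problem (10)–(11)
`Δp = −Σ ∂ᵢuⱼ ∂ⱼuᵢ` in `Ω`, `∂p/∂n = −Σ uᵢuⱼ ∂ᵢnⱼ` on `∂Ω`, the standard `H^s` estimate for `∇p`, the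
trace theorem and Lemma 1 i); the same estimate with `|u|²_s` is Temam 1975 / Kato–Lai 1984 §4).
**Rendering** (`s = 3`, in the smooth periodic class `IsPeriodicCylinderEulerSolution L [0,T) u₀`
of the target: for every time slice, the tree's `H³(cell)` norm of the classical gradient
`∇p(t)` — `C^∞` on the open cylinder — is bounded by
`C ‖u(t)‖_{W^{1,∞}(cell)} ‖u(t)‖_{H³(cell)}`, in `ℝ≥0∞`): for `L > 0` there is `C` such that for every
solution `(u, p)` of the class on `[0, T)` and every `t ∈ [0, T)`,
`‖∇p(t)‖_{H³(cell)} ≤ C ‖u(t)‖_{W^{1,∞}(cell)} ‖u(t)‖_{H³(cell)}`. Adaptation caveat as in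
`Ferrari1993_periodicCylinderH3Bound` (the Neumann problem on the period cell of the periodic
cylinder, periodic in `z`, with the curved wall `{r = 1}`; Kato–Lai 1984 §4, Luo–Hou 2014 §4.4,
Chen–Hou 2021 §9). [cite: Ferrari1993, Lemma 2 pp. 280–281]
[cite: KatoLai1984, §4 (pressure estimate)] [cite: LuoHou2014, §4.4 p. 1744 (use in the periodic cylinder)] -/
def Ferrari1993_periodicCylinderPressureEstimate : Prop :=
  ∀ (L : ℝ) (_hL : 0 < L), ∃ C : ℝ≥0, ∀ (u₀ : ℝ³ → ℝ³) (T : ℝ) (_hT : 0 < T) (u : ℝ → ℝ³ → ℝ³)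
    (p : ℝ → ℝ³ → ℝ) (_hsol : IsPeriodicCylinderEulerSolution L (Ico 0 T) u₀ u p) (t : ℝ)
    (_ht : t ∈ Ico (0 : ℝ) T),
    eSobolevDomainNorm 3 2 (cylinderCell L) volume (gradient (p t)) ≤
      C * eSobolevDomainNorm 1 ∞ (cylinderCell L) volume (u t) *
        eSobolevDomainNorm 3 2 (cylinderCell L) volume (u t)

/-! ### Gronwall for a finite family of energies, measurability-free in the coefficient -/

/-- `√(x + ε²) ≤ √x + ε` for `x, ε ≥ 0`. [folklore] -/
theorem sqrt_add_sq_le {x ε : ℝ} (hx : 0 ≤ x) (hε : 0 ≤ ε) : Real.sqrt (x + ε ^ 2) ≤ Real.sqrt x + ε := by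
  rw [Real.sqrt_le_iff]
  refine ⟨by positivity, ?_⟩
  have h1 : Real.sqrt x ^ 2 = x := Real.sq_sqrt hx
  nlinarith [Real.sqrt_nonneg x, h1]

/-- **Gronwall's inequality for a finite family of energies, sum form with prefactor one.** Let
`E_j`, `j ∈ s₀`, be nonnegative and continuous on `[0, t]`, differentiable on `(0, t)` with
derivatives `φ_j` continuous on `[0, t]`, and suppose `φ_j ≤ 2 √E_j k_j` on `(0, t]` with `k_j ≥ 0`
and `Σ_j k_j(s) ≤ C w(s) Σ_j √E_j(s)`, where `w ≥ 0` is finite on `[0, t]` (no measurability) with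
lower integral `∫⁻_{(0,t)} w ≤ B`. Then `Σ_j √E_j(t) ≤ (Σ_j √E_j(0)) exp(C B)`. Proof: for `ε > 0`
the regularisation `N_ε = Σ_j √(E_j + ε²)` is `C¹` with `N_ε' = Σ_j φ_j / (2√(E_j + ε²)) ≤ Σ_j k_j ≤ C w N_ε`;
by the fundamental theorem of calculus and `ofReal ∫ ≤ ∫⁻ ofReal`,
`N_ε(σ) ≤ N_ε(0) + ∫⁻_{(0,σ)} C w N_ε` in `ℝ≥0∞`, so `lintegral_gronwall_le` gives
`N_ε(t) ≤ N_ε(0) e^{CB}`; finally `Σ√E_j ≤ N_ε ≤ Σ√E_j + #s₀ ε`. This is the Gronwall step (13) ⇒ (14)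
of Ferrari 1993 for the sum-form norm `Σ_{|α| ≤ s} ‖D^α u‖_{L²}`. [folklore] -/
theorem sum_sqrt_le_mul_exp_of_energy_ineq {J : Type*} (s₀ : Finset J) {t : ℝ} (ht : 0 ≤ t)
    {E φ k : J → ℝ → ℝ} {wgt : ℝ → ℝ≥0∞} {C : ℝ} (hC : 0 ≤ C) {B : ℝ≥0}
    (hEc : ∀ j ∈ s₀, ContinuousOn (E j) (Icc 0 t)) (hE0 : ∀ j ∈ s₀, ∀ s ∈ Icc 0 t, 0 ≤ E j s)
    (hEd : ∀ j ∈ s₀, ∀ s ∈ Ioo 0 t, HasDerivAt (E j) (φ j s) s)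
    (hφc : ∀ j ∈ s₀, ContinuousOn (φ j) (Icc 0 t))
    (hφ : ∀ j ∈ s₀, ∀ s ∈ Ioc 0 t, φ j s ≤ 2 * Real.sqrt (E j s) * k j s)
    (hk0 : ∀ j ∈ s₀, ∀ s ∈ Ioc 0 t, 0 ≤ k j s)
    (hk : ∀ s ∈ Ioc 0 t, ∑ j ∈ s₀, k j s ≤ C * (wgt s).toReal * ∑ j ∈ s₀, Real.sqrt (E j s))
    (hw : ∀ s ∈ Icc 0 t, wgt s ≠ ⊤) (hB : ∫⁻ s in Ioo 0 t, wgt s ≤ B) :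
    ∑ j ∈ s₀, Real.sqrt (E j t) ≤ (∑ j ∈ s₀, Real.sqrt (E j 0)) * Real.exp (C * B) := by
  -- the regularised inequality
  have main : ∀ ε : ℝ, 0 < ε → ∑ j ∈ s₀, Real.sqrt (E j t + ε ^ 2) ≤
      (∑ j ∈ s₀, Real.sqrt (E j 0 + ε ^ 2)) * Real.exp (C * B) := by
    intro ε hε
    set Nε : ℝ → ℝ := fun s => ∑ j ∈ s₀, Real.sqrt (E j s + ε ^ 2) with hNε
    set g : ℝ → ℝ := fun s => ∑ j ∈ s₀, φ j s / (2 * Real.sqrt (E j s + ε ^ 2)) with hg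
    have hpos : ∀ j ∈ s₀, ∀ s ∈ Icc 0 t, 0 < E j s + ε ^ 2 := fun j hj s hs => by
      have := hE0 j hj s hs
      positivity
    have hNε0 : ∀ s, 0 ≤ Nε s := fun s => Finset.sum_nonneg fun j _ => Real.sqrt_nonneg _
    -- continuity and differentiability
    have cNε : ContinuousOn Nε (Icc 0 t) :=
      continuousOn_finsetSum _ fun j hj => ((hEc j hj).add continuousOn_const).sqrt
    have cg : ContinuousOn g (Icc 0 t) := by
      refine continuousOn_finsetSum _ fun j hj => (hφc j hj).div
        (continuousOn_const.mul ((hEc j hj).add continuousOn_const).sqrt) fun s hs => ?_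
      exact (mul_pos two_pos (Real.sqrt_pos.2 (hpos j hj s hs))).ne'
    have dNε : ∀ s ∈ Ioo 0 t, HasDerivAt Nε (g s) s := fun s hs =>
      HasDerivAt.fun_sum fun j hj =>
        ((hEd j hj s hs).add_const (ε ^ 2)).sqrt (hpos j hj s (Ioo_subset_Icc_self hs)).ne'
    -- pointwise bound of the derivative
    have gle : ∀ s ∈ Ioc 0 t, g s ≤ C * (wgt s).toReal * Nε s := by
      intro s hs
      have hsI : s ∈ Icc 0 t := ⟨hs.1.le, hs.2⟩
      have hCw : 0 ≤ C * (wgt s).toReal := mul_nonneg hC ENNReal.toReal_nonneg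
      calc g s = ∑ j ∈ s₀, φ j s / (2 * Real.sqrt (E j s + ε ^ 2)) := rfl
        _ ≤ ∑ j ∈ s₀, k j s := Finset.sum_le_sum fun j hj => by
            have h1 := hφ j hj s hs
            have h2 := hk0 j hj s hs
            have hE := hE0 j hj s hsI
            have hsq : Real.sqrt (E j s) ≤ Real.sqrt (E j s + ε ^ 2) :=
              Real.sqrt_le_sqrt (by nlinarith)
            have hden : 0 < 2 * Real.sqrt (E j s + ε ^ 2) :=
              mul_pos two_pos (Real.sqrt_pos.2 (hpos j hj s hsI))
            rw [div_le_iff₀ hden]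
            calc φ j s ≤ 2 * Real.sqrt (E j s) * k j s := h1
              _ ≤ 2 * Real.sqrt (E j s + ε ^ 2) * k j s := by gcongr
              _ = k j s * (2 * Real.sqrt (E j s + ε ^ 2)) := by ring
        _ ≤ C * (wgt s).toReal * ∑ j ∈ s₀, Real.sqrt (E j s) := hk s hs
        _ ≤ C * (wgt s).toReal * Nε s := by
            refine mul_le_mul_of_nonneg_left (Finset.sum_le_sum fun j hj => ?_) hCw
            exact Real.sqrt_le_sqrt (by nlinarith [hE0 j hj s hsI])
    -- the fundamental theorem of calculus
    have ftc : ∀ σ ∈ Icc 0 t, Nε σ - Nε 0 = ∫ τ in Ioc 0 σ, g τ := by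
      intro σ hσ
      have hsub : Icc 0 σ ⊆ Icc 0 t := Icc_subset_Icc_right hσ.2
      have h1 := intervalIntegral.integral_eq_sub_of_hasDerivAt_of_le hσ.1 (cNε.mono hsub)
        (fun τ hτ => dNε τ ⟨hτ.1, hτ.2.trans_le hσ.2⟩)
        ((cg.mono hsub).intervalIntegrable_of_Icc hσ.1)
      rw [intervalIntegral.integral_of_le hσ.1] at h1
      exact h1.symm
    -- the integral inequality in `ℝ≥0∞`
    have ineq : ∀ σ ∈ Icc 0 t, ENNReal.ofReal (Nε σ) ≤ ENNReal.ofReal (Nε 0) +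
        ∫⁻ τ in Ioo 0 σ, (ENNReal.ofReal C * wgt τ) * ENNReal.ofReal (Nε τ) := by
      intro σ hσ
      have hsub : Icc 0 σ ⊆ Icc 0 t := Icc_subset_Icc_right hσ.2
      have ig : IntegrableOn g (Ioc 0 σ) volume :=
        (((cg.mono hsub).integrableOn_compact isCompact_Icc)).mono_set Ioc_subset_Icc_self
      have igp : IntegrableOn (fun τ => max (g τ) 0) (Ioc 0 σ) volume := ig.pos_part
      have h1 : ∫ τ in Ioc 0 σ, g τ ≤ ∫ τ in Ioc 0 σ, max (g τ) 0 :=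
        integral_mono ig igp fun τ => le_max_left _ _
      have h2 : ENNReal.ofReal (∫ τ in Ioc 0 σ, max (g τ) 0) =
          ∫⁻ τ in Ioc 0 σ, ENNReal.ofReal (max (g τ) 0) :=
        ofReal_integral_eq_lintegral_ofReal igp (ae_of_all _ fun τ => le_max_right _ _)
      have h3 : ∫⁻ τ in Ioc 0 σ, ENNReal.ofReal (max (g τ) 0) ≤
          ∫⁻ τ in Ioc 0 σ, (ENNReal.ofReal C * wgt τ) * ENNReal.ofReal (Nε τ) := by
        refine setLIntegral_mono' measurableSet_Ioc fun τ hτ => ?_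
        have hτt : τ ∈ Ioc 0 t := ⟨hτ.1, hτ.2.trans hσ.2⟩
        have hwτ : wgt τ ≠ ⊤ := hw τ ⟨hτ.1.le, hτt.2⟩
        have hgτ := gle τ hτt
        have hnn : 0 ≤ C * (wgt τ).toReal * Nε τ :=
          mul_nonneg (mul_nonneg hC ENNReal.toReal_nonneg) (hNε0 τ)
        calc ENNReal.ofReal (max (g τ) 0) ≤ ENNReal.ofReal (C * (wgt τ).toReal * Nε τ) :=
              ENNReal.ofReal_le_ofReal (max_le hgτ hnn)
          _ = ENNReal.ofReal C * wgt τ * ENNReal.ofReal (Nε τ) := by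
              rw [ENNReal.ofReal_mul (mul_nonneg hC ENNReal.toReal_nonneg), ENNReal.ofReal_mul hC,
                ENNReal.ofReal_toReal hwτ]
      calc ENNReal.ofReal (Nε σ) = ENNReal.ofReal (Nε 0 + (Nε σ - Nε 0)) := by ring_nf
        _ ≤ ENNReal.ofReal (Nε 0) + ENNReal.ofReal (Nε σ - Nε 0) := ENNReal.ofReal_add_le
        _ = ENNReal.ofReal (Nε 0) + ENNReal.ofReal (∫ τ in Ioc 0 σ, g τ) := by rw [ftc σ hσ]
        _ ≤ ENNReal.ofReal (Nε 0) + ENNReal.ofReal (∫ τ in Ioc 0 σ, max (g τ) 0) :=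
            add_le_add le_rfl (ENNReal.ofReal_le_ofReal h1)
        _ ≤ ENNReal.ofReal (Nε 0) + ∫⁻ τ in Ioc 0 σ, (ENNReal.ofReal C * wgt τ) * ENNReal.ofReal (Nε τ) := by
            rw [h2]
            exact add_le_add le_rfl h3
        _ = ENNReal.ofReal (Nε 0) + ∫⁻ τ in Ioo 0 σ, (ENNReal.ofReal C * wgt τ) * ENNReal.ofReal (Nε τ) := by
            rw [lintegral_Ioo_eq_lintegral_Ioc]
    -- Gronwall in `ℝ≥0∞`
    obtain ⟨M, hM⟩ := isCompact_Icc.exists_bound_of_continuousOn cNε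
    have ha : ∫⁻ τ in Ioo 0 t, ENNReal.ofReal C * wgt τ ≠ ⊤ := by
      rw [lintegral_const_mul' _ _ ENNReal.ofReal_ne_top]
      exact ENNReal.mul_ne_top ENNReal.ofReal_ne_top (ne_top_of_le_ne_top ENNReal.coe_ne_top hB)
    have gron := lintegral_gronwall_le (S := t) (φ := fun σ => ENNReal.ofReal (Nε σ))
      (a := fun τ => ENNReal.ofReal C * wgt τ) (B := ENNReal.ofReal (Nε 0)) (M := ENNReal.ofReal M)
      ENNReal.ofReal_ne_top ENNReal.ofReal_ne_top
      (fun σ hσ => ENNReal.ofReal_le_ofReal ((le_abs_self _).trans (by simpa using hM σ hσ)))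
      ha ineq t ⟨ht, le_rfl⟩
    have hI : (∫⁻ τ in Ioo 0 t, ENNReal.ofReal C * wgt τ).toReal ≤ C * B := by
      rw [lintegral_const_mul' _ _ ENNReal.ofReal_ne_top, ENNReal.toReal_mul,
        ENNReal.toReal_ofReal hC]
      refine mul_le_mul_of_nonneg_left ?_ hC
      have := ENNReal.toReal_mono ENNReal.coe_ne_top hB
      rwa [ENNReal.coe_toReal] at this
    have fin : ENNReal.ofReal (Nε t) ≤ ENNReal.ofReal (Nε 0 * Real.exp (C * B)) := by
      refine gron.trans ?_
      rw [ENNReal.ofReal_mul (hNε0 0)]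
      exact mul_le_mul' le_rfl (ENNReal.ofReal_le_ofReal (Real.exp_le_exp.2 hI))
    exact (ENNReal.ofReal_le_ofReal_iff (mul_nonneg (hNε0 0) (Real.exp_pos _).le)).1 fin
  -- let `ε → 0`
  have h0I : (0 : ℝ) ∈ Icc 0 t := ⟨le_rfl, ht⟩
  have htI : t ∈ Icc 0 t := ⟨ht, le_rfl⟩
  set A : ℝ := ∑ j ∈ s₀, Real.sqrt (E j t) with hA
  set A₀ : ℝ := ∑ j ∈ s₀, Real.sqrt (E j 0) with hA₀
  set Kc : ℝ := s₀.card * Real.exp (C * B) with hKc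
  have hKc0 : 0 ≤ Kc := by positivity
  have step : ∀ ε : ℝ, 0 < ε → A ≤ A₀ * Real.exp (C * B) + ε * Kc := by
    intro ε hε
    have h1 : A ≤ ∑ j ∈ s₀, Real.sqrt (E j t + ε ^ 2) :=
      Finset.sum_le_sum fun j hj => Real.sqrt_le_sqrt (by nlinarith [hE0 j hj t htI])
    have h2 : ∑ j ∈ s₀, Real.sqrt (E j 0 + ε ^ 2) ≤ A₀ + s₀.card * ε := by
      calc ∑ j ∈ s₀, Real.sqrt (E j 0 + ε ^ 2) ≤ ∑ j ∈ s₀, (Real.sqrt (E j 0) + ε) :=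
            Finset.sum_le_sum fun j hj => sqrt_add_sq_le (hE0 j hj 0 h0I) hε.le
        _ = A₀ + s₀.card * ε := by
            rw [Finset.sum_add_distrib, Finset.sum_const, nsmul_eq_mul]
    have h3 := main ε hε
    have hexp : 0 ≤ Real.exp (C * B) := (Real.exp_pos _).le
    calc A ≤ ∑ j ∈ s₀, Real.sqrt (E j t + ε ^ 2) := h1
      _ ≤ (∑ j ∈ s₀, Real.sqrt (E j 0 + ε ^ 2)) * Real.exp (C * B) := h3
      _ ≤ (A₀ + s₀.card * ε) * Real.exp (C * B) := by gcongr
      _ = A₀ * Real.exp (C * B) + ε * Kc := by rw [hKc]; ring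
  refine le_of_forall_pos_lt_add fun ε hε => ?_
  have h := step (ε / (Kc + 1)) (by positivity)
  calc A ≤ A₀ * Real.exp (C * B) + ε / (Kc + 1) * Kc := h
    _ < A₀ * Real.exp (C * B) + ε := by
        have : ε / (Kc + 1) * Kc < ε := by
          rw [div_mul_eq_mul_div, div_lt_iff₀ (by positivity)]
          nlinarith
        linarith

/-! ### The reduction -/

/-- The finite set of words of length `≤ 3` in the basis directions, as a `Finset` of the sigma
type `Σ m, (Fin m → ι)`. [folklore] -/
def wordIndex : Finset (Σ m : ℕ, (Fin m → Fin (Module.finrank ℝ ℝ³))) :=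
  (Finset.range 4).sigma fun _ => Finset.univ

/-- Double sums over `m < 4` and words of length `m` are sums over `wordIndex`. [folklore] -/
theorem sum_wordIndex {M : Type*} [AddCommMonoid M]
    (f : (m : ℕ) → (Fin m → Fin (Module.finrank ℝ ℝ³)) → M) :
    ∑ j ∈ wordIndex, f j.1 j.2 = ∑ m ∈ Finset.range 4, ∑ w : Fin m → Fin (Module.finrank ℝ ℝ³), f m w := by
  rw [wordIndex, Finset.sum_sigma]

/-- **`Ferrari1993_periodicCylinderHsEnergyInequality` from the commutator estimate and the
pressure estimate** (Ferrari 1993, (8) ⇒ (9) ⇒ (13) ⇒ (14), pp. 280–281, in the smooth periodic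
class, for the sum-form `H³(cell)` norm with prefactor `1`). For a solution `(u, p)` on `[0, T)`,
`t < T` and a bound `B` of `∫⁻_{(0,t)} ‖u‖_{W^{1,∞}(cell)}`: the word energies
`E_w(s) = ∫_cell ‖D_w u(s)‖²`, `|w| ≤ 3` (`cylWordField`), are continuous on `[0, t]` and
differentiable inside with derivative `∫ 2⟪D_w u, ∂ₜD_w u⟫ ≤ 2 √E_w (‖[D_w,u·∇]u‖_{L²} + ‖D_w∇p‖_{L²})`
(`IsPeriodicCylinderEulerSolution.cellEnergyFlux_wordField_le`), the two facts bound the bracket,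
summed over the words, by `#words·(C₁ + C₂) ‖u‖_{W^{1,∞}} ‖u‖_{H³}`, and
`‖u(s)‖_{H³(cell)} = Σ_w √E_w(s)` by the word expansion of the norm; conclude by
`sum_sqrt_le_mul_exp_of_energy_ineq`. [cite: Ferrari1993, (8)–(14) pp. 280–281] -/
theorem Ferrari1993_periodicCylinderHsEnergyInequality_of_commutator_of_pressure
    (hCE : Ferrari1993_periodicCylinderCommutatorEstimate)
    (hPE : Ferrari1993_periodicCylinderPressureEstimate) :
    Ferrari1993_periodicCylinderHsEnergyInequality := by
  intro L hL
  obtain ⟨C₁, hC₁⟩ := hCE L hL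
  obtain ⟨C₂, hC₂⟩ := hPE L hL
  refine ⟨(wordIndex.card : ℝ≥0) * (C₁ + C₂), ?_⟩
  intro u₀ T hT u p hsol t ht B hB
  -- notation
  set S : Set ℝ := Ico 0 T with hS_def
  set K : Set ℝ³ := closure (unitCylinder : Set ℝ³) with hK_def
  set Ω : Set ℝ³ := (cylinderCell L : Set ℝ³) with hΩ_def
  have hS : UniqueDiffOn ℝ S := uniqueDiffOn_Ico 0 T
  have hΩmeas : MeasurableSet Ω := (cylinderCell L).isOpen.measurableSet
  have hIccS : Icc 0 t ⊆ S := fun s hs => ⟨hs.1, hs.2.trans_lt ht.2⟩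
  have hIocT : ∀ s ∈ Ioc 0 t, s ∈ Ioo 0 T := fun s hs => ⟨hs.1, hs.2.trans_lt ht.2⟩
  have hu : ContDiffOn ℝ ∞ (uncurry u) (S ×ˢ K) := hsol.smooth_velocity
  -- the families indexed by words
  set W : (m : ℕ) → (Fin m → Fin (Module.finrank ℝ ℝ³)) → ℝ → ℝ³ → ℝ³ :=
    fun m w => cylWordField T m w u with hW
  set E : (Σ m : ℕ, (Fin m → Fin (Module.finrank ℝ ℝ³))) → ℝ → ℝ :=
    fun j s => ∫ x in Ω, ‖W j.1 j.2 s x‖ ^ 2 with hE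
  set φ : (Σ m : ℕ, (Fin m → Fin (Module.finrank ℝ ℝ³))) → ℝ → ℝ :=
    fun j s => ∫ x in Ω, 2 * ⟪W j.1 j.2 s x, timeDerivWithin S (W j.1 j.2) s x⟫ with hφ
  set l2 : (ℝ³ → ℝ³) → ℝ := fun f => (eLpNorm f 2 (volume.restrict Ω)).toReal with hl2
  set k : (Σ m : ℕ, (Fin m → Fin (Module.finrank ℝ ℝ³))) → ℝ → ℝ :=
    fun j s => l2 (convectionCommutator j.1 j.2 (u s)) +
      l2 (iterDeriv j.1 (sobolevDir j.2) (gradient (p s))) with hk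
  set wgt : ℝ → ℝ≥0∞ := fun s => eSobolevDomainNorm 1 ∞ (cylinderCell L) volume (u s) with hwgt
  set Nn : ℝ → ℝ≥0∞ := fun s => eSobolevDomainNorm 3 2 (cylinderCell L) volume (u s) with hNn
  -- smoothness of the word fields
  have hWsm : ∀ m w, ContDiffOn ℝ ∞ (uncurry (W m w)) (S ×ˢ K) := fun m w =>
    contDiffOn_uncurry_cylWordField hu
  have hW1 : ∀ m w, ContDiffOn ℝ 1 (uncurry (W m w)) (S ×ˢ K) := fun m w =>
    (hWsm m w).of_le (by exact_mod_cast le_top)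
  -- finiteness of the norms of the slices on `[0, t]`
  obtain ⟨Mw, hMw⟩ := hsol.exists_forall_eSobolevDomainNorm_le 1 ∞ (b := t) ht.2
  obtain ⟨Mn, hMn⟩ := hsol.exists_forall_eSobolevDomainNorm_le 3 2 (b := t) ht.2
  have hwfin : ∀ s ∈ Icc 0 t, wgt s ≠ ⊤ := fun s hs => ((hMw s hs).trans_lt ENNReal.coe_lt_top).ne
  have hNfin : ∀ s ∈ Icc 0 t, Nn s ≠ ⊤ := fun s hs => ((hMn s hs).trans_lt ENNReal.coe_lt_top).ne
  -- the `L²` norms of the word fields and the word expansion of the `H³` norm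
  have hmemW : ∀ m w, ∀ s ∈ S, MemLp (W m w s) 2 (volume.restrict Ω) := fun m w s hs =>
    memLp_two_cylinderCell_of_continuousOn L (contDiffOn_slice_of_contDiffOn_uncurry (hWsm m w) hs).continuousOn
  have hEeq : ∀ j, ∀ s ∈ S, E j s = (l2 (W j.1 j.2 s)) ^ 2 := fun j s hs =>
    integral_norm_sq_eq_toReal_eLpNorm_two_sq (hmemW j.1 j.2 s hs)
  have hsqrtE : ∀ j, ∀ s ∈ S, Real.sqrt (E j s) = l2 (W j.1 j.2 s) := fun j s hs => by
    rw [hEeq j s hs, Real.sqrt_sq ENNReal.toReal_nonneg]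
  have hexpand : ∀ s ∈ S, Nn s = ∑ m ∈ Finset.range 4, ∑ w : Fin m → Fin (Module.finrank ℝ ℝ³),
      eLpNorm (W m w s) 2 (volume.restrict Ω) := by
    intro s hs
    have husΩ : ContDiffOn ℝ ∞ (u s) (cylinderCell L : Set ℝ³) :=
      (contDiffOn_slice_of_contDiffOn_uncurry hu hs).mono
        (fun x hx => subset_closure (cylinderCell_le_unitCylinder L hx))
    rw [hNn]
    simp only
    rw [eSobolevDomainNorm_eq_sum_iterDeriv 2 3 husΩ]
    refine Finset.sum_congr rfl fun m _ => Finset.sum_congr rfl fun w _ => ?_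
    refine eLpNorm_congr_ae (ae_restrict_of_forall_mem hΩmeas fun x hx => ?_)
    exact (cylWordField_eqOn hu hs (cylinderCell_le_unitCylinder L hx)).symm
  have hNsum : ∀ s ∈ Icc 0 t, (Nn s).toReal = ∑ j ∈ wordIndex, Real.sqrt (E j s) := by
    intro s hs
    have hsS : s ∈ S := hIccS hs
    rw [hexpand s hsS, ENNReal.toReal_sum (fun m _ => ENNReal.sum_ne_top.2 fun w _ =>
      (hmemW m w s hsS).eLpNorm_ne_top), wordIndex, Finset.sum_sigma]
    refine Finset.sum_congr rfl fun m _ => ?_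
    rw [ENNReal.toReal_sum fun w _ => (hmemW m w s hsS).eLpNorm_ne_top]
    exact Finset.sum_congr rfl fun w _ => (hsqrtE ⟨m, w⟩ s hsS).symm
  -- the two facts, at each time, in real form
  have hfacts : ∀ j ∈ wordIndex, ∀ s ∈ Icc 0 t,
      eLpNorm (convectionCommutator j.1 j.2 (u s)) 2 (volume.restrict Ω) ≠ ⊤ ∧
      eLpNorm (iterDeriv j.1 (sobolevDir j.2) (gradient (p s))) 2 (volume.restrict Ω) ≠ ⊤ ∧
      k j s ≤ (C₁ + C₂) * (wgt s).toReal * (Nn s).toReal := by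
    rintro ⟨m, w⟩ hj s hs
    have hsS : s ∈ S := hIccS hs
    have hm : m ≤ 3 := by
      have : m ∈ Finset.range 4 := (Finset.mem_sigma.1 hj).1
      exact Nat.lt_succ_iff.1 (Finset.mem_range.1 this)
    have hus : ContDiffOn ℝ ∞ (u s) K := contDiffOn_slice_of_contDiffOn_uncurry hu hsS
    have hfinprod : (C₁ : ℝ≥0∞) * wgt s * Nn s ≠ ⊤ :=
      ENNReal.mul_ne_top (ENNReal.mul_ne_top ENNReal.coe_ne_top (hwfin s hs)) (hNfin s hs)
    have hfinprod' : (C₂ : ℝ≥0∞) * wgt s * Nn s ≠ ⊤ :=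
      ENNReal.mul_ne_top (ENNReal.mul_ne_top ENNReal.coe_ne_top (hwfin s hs)) (hNfin s hs)
    -- commutator
    have h1 := hC₁ (u s) hus (hsol.periodic s hsS).1 m hm w
    have h1fin : eLpNorm (convectionCommutator m w (u s)) 2 (volume.restrict Ω) ≠ ⊤ :=
      ne_top_of_le_ne_top hfinprod h1
    have h1r : l2 (convectionCommutator m w (u s)) ≤ C₁ * (wgt s).toReal * (Nn s).toReal := by
      have := ENNReal.toReal_mono hfinprod h1
      rwa [ENNReal.toReal_mul, ENNReal.toReal_mul, ENNReal.coe_toReal] at this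
    -- pressure: one summand of the word expansion of `‖∇p(s)‖_{H³(cell)}`
    have hps : ContDiffOn ℝ ∞ (p s) K := contDiffOn_slice_of_contDiffOn_uncurry hsol.smooth_pressure hsS
    have hgradΩ : ContDiffOn ℝ ∞ (gradient (p s)) (cylinderCell L : Set ℝ³) :=
      (contDiffOn_gradient_of_isOpen unitCylinder.isOpen (hps.mono subset_closure)).mono
        (cylinderCell_le_unitCylinder L)
    have h2 := hC₂ u₀ T hT u p hsol s hsS
    have hsummand : eLpNorm (iterDeriv m (sobolevDir w) (gradient (p s))) 2 (volume.restrict Ω) ≤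
        eSobolevDomainNorm 3 2 (cylinderCell L) volume (gradient (p s)) := by
      rw [eSobolevDomainNorm_eq_sum_iterDeriv 2 3 hgradΩ]
      have hmr : m ∈ Finset.range 4 := Finset.mem_range.2 (Nat.lt_succ_iff.2 hm)
      refine le_trans ?_ (Finset.single_le_sum (f := fun m' => ∑ w' : Fin m' → Fin (Module.finrank ℝ ℝ³),
        eLpNorm (iterDeriv m' (fun j => Module.finBasis ℝ ℝ³ (w' j)) (gradient (p s))) 2
          (volume.restrict Ω)) (fun _ _ => zero_le) hmr)
      exact Finset.single_le_sum (f := fun w' : Fin m → Fin (Module.finrank ℝ ℝ³) =>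
        eLpNorm (iterDeriv m (fun j => Module.finBasis ℝ ℝ³ (w' j)) (gradient (p s))) 2
          (volume.restrict Ω)) (fun _ _ => zero_le) (Finset.mem_univ w)
    have h2' := hsummand.trans h2
    have h2fin : eLpNorm (iterDeriv m (sobolevDir w) (gradient (p s))) 2 (volume.restrict Ω) ≠ ⊤ :=
      ne_top_of_le_ne_top hfinprod' h2'
    have h2r : l2 (iterDeriv m (sobolevDir w) (gradient (p s))) ≤ C₂ * (wgt s).toReal * (Nn s).toReal := by
      have := ENNReal.toReal_mono hfinprod' h2'
      rwa [ENNReal.toReal_mul, ENNReal.toReal_mul, ENNReal.coe_toReal] at this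
    refine ⟨h1fin, h2fin, ?_⟩
    simp only [hk]
    nlinarith [h1r, h2r]
  -- the hypotheses of the abstract Gronwall lemma
  have hEc : ∀ j ∈ wordIndex, ContinuousOn (E j) (Icc 0 t) := fun j _ =>
    continuousOn_cellEnergy (hW1 j.1 j.2) hIccS L
  have hE0 : ∀ j ∈ wordIndex, ∀ s ∈ Icc 0 t, 0 ≤ E j s := fun j _ s _ =>
    setIntegral_nonneg hΩmeas fun x _ => sq_nonneg _
  have hEd : ∀ j ∈ wordIndex, ∀ s ∈ Ioo 0 t, HasDerivAt (E j) (φ j s) s := fun j _ s hs =>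
    hasDerivAt_cellEnergy (hW1 j.1 j.2) hS hIccS L hs
  have hφc : ∀ j ∈ wordIndex, ContinuousOn (φ j) (Icc 0 t) := fun j _ =>
    continuousOn_cellEnergyFlux (hW1 j.1 j.2) hS hIccS L
  have hφle : ∀ j ∈ wordIndex, ∀ s ∈ Ioc 0 t, φ j s ≤ 2 * Real.sqrt (E j s) * k j s := by
    intro j hj s hs
    have hsS : s ∈ S := hIccS ⟨hs.1.le, hs.2⟩
    obtain ⟨hf1, hf2, -⟩ := hfacts j hj s ⟨hs.1.le, hs.2⟩
    have key := hsol.cellEnergyFlux_wordField_le hL j.1 j.2 (hIocT s hs) hf1 hf2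
    rw [hsqrtE j s hsS]
    simpa only [hφ, hk, hl2, hW] using key
  have hk0 : ∀ j ∈ wordIndex, ∀ s ∈ Ioc 0 t, 0 ≤ k j s := fun j _ s _ =>
    add_nonneg ENNReal.toReal_nonneg ENNReal.toReal_nonneg
  have hCnn : (0 : ℝ) ≤ wordIndex.card * (C₁ + C₂) := by positivity
  have hksum : ∀ s ∈ Ioc 0 t, ∑ j ∈ wordIndex, k j s ≤
      (wordIndex.card * (C₁ + C₂)) * (wgt s).toReal * ∑ j ∈ wordIndex, Real.sqrt (E j s) := by
    intro s hs
    have hsI : s ∈ Icc 0 t := ⟨hs.1.le, hs.2⟩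
    rw [← hNsum s hsI]
    calc ∑ j ∈ wordIndex, k j s ≤ ∑ j ∈ wordIndex, (C₁ + C₂) * (wgt s).toReal * (Nn s).toReal :=
          Finset.sum_le_sum fun j hj => (hfacts j hj s hsI).2.2
      _ = (wordIndex.card * (C₁ + C₂)) * (wgt s).toReal * (Nn s).toReal := by
          rw [Finset.sum_const, nsmul_eq_mul]
          ring
  -- Gronwall
  have main := sum_sqrt_le_mul_exp_of_energy_ineq wordIndex ht.1 hCnn hEc hE0 hEd hφc hφle hk0
    hksum hwfin hB
  rw [← hNsum t ⟨ht.1, le_rfl⟩, ← hNsum 0 ⟨le_rfl, ht.1⟩] at main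
  -- back to `ℝ≥0∞`
  have h0S : (0 : ℝ) ∈ S := ⟨le_rfl, hT⟩
  have hN0 : Nn 0 = eSobolevDomainNorm 3 2 (cylinderCell L) volume u₀ := by
    simp only [hNn, hsol.initial]
  calc eSobolevDomainNorm 3 2 (cylinderCell L) volume (u t) = Nn t := rfl
    _ = ENNReal.ofReal (Nn t).toReal := (ENNReal.ofReal_toReal (hNfin t ⟨ht.1, le_rfl⟩)).symm
    _ ≤ ENNReal.ofReal ((Nn 0).toReal * Real.exp ((wordIndex.card * (C₁ + C₂)) * B)) :=
        ENNReal.ofReal_le_ofReal main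
    _ = Nn 0 * ENNReal.ofReal (Real.exp ((wordIndex.card * (C₁ + C₂)) * B)) := by
        rw [ENNReal.ofReal_mul ENNReal.toReal_nonneg, ENNReal.ofReal_toReal (hNfin 0 ⟨le_rfl, ht.1⟩)]
    _ = eSobolevDomainNorm 3 2 (cylinderCell L) volume u₀ *
          ENNReal.ofReal (Real.exp (((wordIndex.card : ℝ≥0) * (C₁ + C₂) : ℝ≥0) * B)) := by
        rw [hN0]
        push_cast
        ring_nf

/-! ### Consequences: the chain on single-estimate facts -/

/-- **`Ferrari1993_periodicCylinderH3Bound` from the three single-estimate facts**: the commutator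
estimate (Ferrari's display after Lemma 1), the pressure estimate (Lemma 2), the stationary
logarithmic div–curl estimate (Shirota–Yanagisawa (15) / Ferrari Prop. 1) — everything else in
Ferrari's proof of (4) ⇒ (7) (energy identity, Gauss–Green, Gronwall twice, energy conservation,
time regularity of the smooth class) being proved in the tree. [cite: Ferrari1993, proof of Thm 2, (8)–(17) pp. 280–282] -/
theorem Ferrari1993_periodicCylinderH3Bound_of_commutator_of_pressure_of_divCurl
    (hCE : Ferrari1993_periodicCylinderCommutatorEstimate)
    (hPE : Ferrari1993_periodicCylinderPressureEstimate)
    (hDC : ShirotaYanagisawa1993_periodicCylinderLogDivCurlEstimate) :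
    Ferrari1993_periodicCylinderH3Bound :=
  Ferrari1993_periodicCylinderH3Bound_of_energyInequality_of_divCurl
    (Ferrari1993_periodicCylinderHsEnergyInequality_of_commutator_of_pressure hCE hPE) hDC

end Literature.Analysis.FluidPDE
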